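import Mathlib.LinearAlgebra.QuadraticForm.IsometryEquiv
import Literature.NumberTheory.Weil1964.LocalGaussIntegralSeveralVariables
import Literature.NumberTheory.Weil1964.LocalLinearChangeOfVariables
import HarnessLib

/-!
# The Weil index `γ(f)` of a non-degenerate quadratic form on `Fⁿ` over a non-archimedean local field

Topic `NumberTheory/Weil1964`; namespace `Literature.NumberTheory.Weil1964`. KERNEL mathematics only
(plumbing definitions with bodies + theorems; no named fact, no `axiom`, no `sorry`). Sequel of
`LocalGaussIntegralSeveralVariables.lean` (diagonal forms over arbitrary lattices) and
`LocalLinearChangeOfVariables.lean` (`A_* μ^⊗ι = ‖det A‖⁻¹ μ^⊗ι`): Weil's n° 25–27 for a GENERAL non-degenerate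
quadratic form `f` on `X = F^ι` (`F` a non-archimedean local field with `2 ≠ 0`, i.e. of characteristic `≠ 2`
— in characteristic `2` no quadratic form `x ↦ f(x)` with values in `F` is non-degenerate in Weil's sense,
[Weil1964] n° 23 p. 172).

For `f : QuadraticForm F (ι → F)`, an additive Haar measure `μ` on `F` and a non-trivial continuous character `ψ`:

* §0 `g(f, D) = ∫_D ψ(f(x)) dμ^⊗ι` (`gaussQF`), the stable value `g(f) = lim_M g(f, M)` over the box lattices
  (`weilGaussQF`) and the **Weil index `γ(f) = g(f)/|g(f)|`** (`weilIndexQF`) — [Weil1964] n° 24 p. 173 / n° 27 p. 175;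
  for the diagonal forms `weightedSumSquares F c` these are the objects of `LocalGaussIntegralSeveralVariables`;
* §1 every compact subset of `F^ι` lies in a box lattice; a linear map sends box lattices into box lattices;
* §2 DIAGONALISATION on `F^ι` (char `≠ 2`): `f = (Σ cᵢ xᵢ²) ∘ A` with `A ∈ GL(F^ι)`, all `cᵢ ≠ 0` (Mathlib's orthogonal
  bases, re-indexed by `ι`);
* §3 CHANGE OF VARIABLES `g(f ∘ A, D) = ‖det A‖⁻¹ g(f, A D)` (n° 25: "si `f' = f ∘ ρ` … `γ(f') = γ(f)`");
* §4 **STABILISATION AND INDEPENDENCE OF THE LATTICE** for non-degenerate `f` (n° 27): there are `ℓ, m₀` such that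
  `g(f, D) = g(f)` for every compact `D ⊇ (𝔭^{m₀})^ι` saturated by `(𝔭^ℓ)^ι`; `g(f, (𝔭^m)^ι) = g(f)` for `m ≪ 0`;
  `g(f) = ‖det A‖⁻¹ Πᵢ g(cᵢ) ≠ 0` for ANY diagonalisation; `|γ(f)| = 1`;
* §5 **`γ(f) = Πᵢ γ(cᵢ xᵢ²)`** for any diagonalisation (n° 25 Prop. 3 for the diagonal pieces), **`γ(f ∘ A) = γ(f)`**
  (n° 25, equivalent forms), `γ(-f) = conj γ(f)` (n° 25), **`γ(f₁ ⊕ f₂) = γ(f₁) γ(f₂)`** for forms in disjoint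
  sets of variables (n° 25 Prop. 3), the HYPERBOLIC PLANE `γ(x y) = 1` (n° 25: "une forme triviale … `γ(f) = 1`"),
  and independence of the Haar measure.

## References

* [Weil1964] A. Weil, *Sur certains groupes d'opérateurs unitaires*, Acta Math. 111 (1964) 143–211, Chap. II
  n° 23–25 (pp. 171–173, Prop. 3), n° 27 (pp. 174–175).
* [WeilBNT1967] A. Weil, *Basic Number Theory* (1967), Chap. I §2 Th. 3 Cor. 3 (`mod_V(A) = mod_K(det A)`).
-/

set_option autoImplicit false

noncomputable section

open MeasureTheory ValuativeRel Filter Topology Set QuadraticMap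
open scoped NNReal ENNReal Pointwise
open Literature.NumberTheory.GaloisRepresentations.IsNonarchimedeanLocalField
open Literature.NumberTheory.Automorphic

namespace Literature.NumberTheory.Weil1964

/-! ## §0 Gauss integrals, stable value and Weil index of a quadratic form on `F^ι` -/

section Defs

variable {F : Type*} [Field F] {ι : Type*} (ψ : AddChar F Circle)

/-- the second-degree character `x ↦ ψ(f(x))` of a quadratic form `f` on `F^ι` (`χ ∘ f`).
[cite: Weil1964, Chap. II n° 24, p. 172] -/
def psiQF (Q : QuadraticForm F (ι → F)) (x : ι → F) : ℂ := ψ (Q x)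

/-- unfolding. [cite: Weil1964, Chap. II n° 24, p. 172] -/
theorem psiQF_apply (Q : QuadraticForm F (ι → F)) (x : ι → F) : psiQF ψ Q x = ψ (Q x) := rfl

/-- `|ψ(f(x))| = 1`. [cite: Weil1964, Chap. I n° 2, p. 146] -/
theorem norm_psiQF (Q : QuadraticForm F (ι → F)) (x : ι → F) : ‖psiQF ψ Q x‖ = 1 := Circle.norm_coe _

/-- `χ ∘ (f ∘ A) = (χ ∘ f) ∘ A`. [cite: Weil1964, Chap. II n° 25, p. 173] -/
theorem psiQF_comp (Q : QuadraticForm F (ι → F)) (A : (ι → F) →ₗ[F] (ι → F)) (x : ι → F) :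
    psiQF ψ (Q.comp A) x = psiQF ψ Q (A x) := rfl

/-- `χ ∘ (-f)` is the complex conjugate of `χ ∘ f`. [cite: Weil1964, Chap. II n° 25, p. 173] -/
theorem psiQF_neg (Q : QuadraticForm F (ι → F)) (x : ι → F) : psiQF ψ (-Q) x = (starRingEnd ℂ) (psiQF ψ Q x) := by
  rw [psiQF, psiQF, QuadraticMap.neg_apply, AddChar.map_neg_eq_inv, Circle.coe_inv_eq_conj]

variable [Fintype ι]

/-- for the diagonal form `Σ cᵢ xᵢ²` (`weightedSumSquares F c`) the character is `Πᵢ ψ(cᵢ xᵢ²)`.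
[cite: Weil1964, Chap. II n° 25, p. 173] -/
theorem psiQF_weightedSumSquares (c : ι → F) : psiQF ψ (weightedSumSquares F c) = psiSqPi ψ c := by
  funext x
  rw [psiQF, psiSqPi_apply, weightedSumSquares_apply]
  congr 2
  exact Finset.sum_congr rfl fun i _ => by rw [smul_eq_mul, pow_two]

variable [MeasurableSpace F] (μ : Measure F)

/-- **Weil's Gauss integral** `g(f, D) = ∫_D χ(f(x)) dx` of the quadratic form `f` on `F^ι` over `D ⊆ F^ι`
(product measure `μ^⊗ι`). [cite: Weil1964, Chap. II n° 27, p. 175] -/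
def gaussQF (Q : QuadraticForm F (ι → F)) (D : Set (ι → F)) : ℂ :=
  ∫ x in D, psiQF ψ Q x ∂(Measure.pi fun _ : ι => μ)

/-- unfolding. [cite: Weil1964, Chap. II n° 27, p. 175] -/
theorem gaussQF_def (Q : QuadraticForm F (ι → F)) (D : Set (ι → F)) :
    gaussQF ψ μ Q D = ∫ x in D, psiQF ψ Q x ∂(Measure.pi fun _ : ι => μ) := rfl

/-- for diagonal forms `g(Σ cᵢ xᵢ², D)` is the `gaussPi` of `LocalGaussIntegralSeveralVariables`.
[cite: Weil1964, Chap. II n° 27, p. 175] -/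
theorem gaussQF_weightedSumSquares (c : ι → F) (D : Set (ι → F)) :
    gaussQF ψ μ (weightedSumSquares F c) D = gaussPi ψ μ c D := by
  rw [gaussQF, psiQF_weightedSumSquares, gaussPi_def]

/-- `g(-f, D) = conj g(f, D)`. [cite: Weil1964, Chap. II n° 25, p. 173] -/
theorem gaussQF_neg (Q : QuadraticForm F (ι → F)) (D : Set (ι → F)) :
    gaussQF ψ μ (-Q) D = (starRingEnd ℂ) (gaussQF ψ μ Q D) := by
  rw [gaussQF, gaussQF, ← integral_conj]
  exact integral_congr_ae (Eventually.of_forall fun x => psiQF_neg ψ Q x)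

variable [ValuativeRel F] [TopologicalSpace F] [IsNonarchimedeanLocalField F]

/-- **Weil's stable value** `g(f) = lim_M g(f, M)` over the box lattices `M = (𝔭^m)^ι`, `m → -∞` (a genuine limit for
non-degenerate `f`: the sequence is eventually constant, `eventually_gaussQF_primePowPiBox_eq`).
[cite: Weil1964, Chap. II n° 27, p. 175] -/
def weilGaussQF (Q : QuadraticForm F (ι → F)) : ℂ :=
  limUnder atBot fun m : ℤ => gaussQF ψ μ Q (primePowPiBox F ι m)

/-- **The Weil index** `γ(f) = g(f)/|g(f)|` of a quadratic form `f` on `F^ι` (for non-degenerate `f` a complex number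
of absolute value `1`, `norm_weilIndexQF`; Weil's `γ(f)` of Chap. I Th. 2 computed through n° 27).
[cite: Weil1964, Chap. II n° 24 p. 173 and n° 27 p. 175] -/
def weilIndexQF (Q : QuadraticForm F (ι → F)) : ℂ :=
  weilGaussQF ψ μ Q / (‖weilGaussQF ψ μ Q‖ : ℂ)

/-- unfolding. [cite: Weil1964, Chap. II n° 27, p. 175] -/
theorem weilIndexQF_def (Q : QuadraticForm F (ι → F)) :
    weilIndexQF ψ μ Q = weilGaussQF ψ μ Q / (‖weilGaussQF ψ μ Q‖ : ℂ) := rfl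

end Defs

variable {F : Type*} [Field F] [ValuativeRel F] [TopologicalSpace F] [IsNonarchimedeanLocalField F]
variable {ι : Type*} [Fintype ι]

/-- `F` is second countable (instance helper). [folklore] -/
private theorem secondCountable : SecondCountableTopology F := secondCountableTopology_localField F

/-! ## §1 Compact sets and linear images of box lattices lie in box lattices -/

section Bounded

/-- **a compact subset of `F` lies in some ball `𝔭^m`** (`F = ⋃_m 𝔭^m`, an increasing union of open subgroups).
[cite: Weil1964, Chap. II n° 27, p. 174] -/
theorem exists_subset_primePowBall_of_isCompact {K : Set F} (hK : IsCompact K) : ∃ m : ℤ, K ⊆ primePowBall F m := by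
  obtain ⟨n, hn⟩ := hK.elim_directed_cover (fun n : ℕ => primePowBall F (-(n : ℤ)))
    (fun n => isOpen_primePowBall _) (fun x _ => by
      obtain ⟨m, hm⟩ := exists_mem_primePowBall x
      exact Set.mem_iUnion.2 ⟨m.natAbs, primePowBall_antitone (by omega) hm⟩)
    (Monotone.directed_le fun n n' h => primePowBall_antitone (by omega))
  exact ⟨_, hn⟩

/-- **a compact subset of `F^ι` lies in some box lattice `(𝔭^m)^ι`** (every "réseau" is as large as one wants).
[cite: Weil1964, Chap. II n° 27, p. 174] -/
theorem exists_subset_primePowPiBox_of_isCompact {K : Set (ι → F)} (hK : IsCompact K) :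
    ∃ m : ℤ, K ⊆ primePowPiBox F ι m := by
  classical
  choose m hm using fun i => exists_subset_primePowBall_of_isCompact (hK.image (continuous_apply i))
  refine ⟨-∑ i, |m i|, fun x hx => mem_primePowPiBox_iff.2 fun i => ?_⟩
  have hi : -∑ j, |m j| ≤ m i := by
    have h1 : |m i| ≤ ∑ j, |m j| :=
      Finset.single_le_sum (f := fun j => |m j|) (fun j _ => abs_nonneg (m j)) (Finset.mem_univ i)
    have h2 := neg_abs_le (m i)
    omega
  exact primePowBall_antitone hi (hm i ⟨x, hx, rfl⟩)

/-- **a linear map sends each box lattice into a box lattice**: `A((𝔭^ℓ)^ι) ⊆ (𝔭^m)^ι` for some `m` (continuity and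
compactness). [cite: Weil1964, Chap. II n° 27, p. 174] -/
theorem exists_image_primePowPiBox_subset (A : (ι → F) →ₗ[F] (ι → F)) (ℓ : ℤ) :
    ∃ m : ℤ, A '' primePowPiBox F ι ℓ ⊆ primePowPiBox F ι m :=
  exists_subset_primePowPiBox_of_isCompact ((isCompact_primePowPiBox ℓ).image (LinearMap.continuous_on_pi A))

end Bounded

/-! ## §2 Diagonalisation on `F^ι` -/

section Diagonal

omit [ValuativeRel F] [TopologicalSpace F] [IsNonarchimedeanLocalField F] in
/-- **diagonalisation in the given coordinates**: over a field with `2` invertible, a non-degenerate quadratic form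
`f` on `F^ι` is `f = (Σᵢ cᵢ xᵢ²) ∘ A` for some `A ∈ GL(F^ι)` and `cᵢ ≠ 0` (an orthogonal basis, [Weil1964] n° 25:
every non-degenerate form is equivalent to a diagonal one; Mathlib's `exists_orthogonal_basis` re-indexed by `ι`).
[cite: Weil1964, Chap. II n° 25, p. 173] -/
theorem exists_weightedSumSquares_linearEquiv [Invertible (2 : F)] (Q : QuadraticForm F (ι → F))
    (hQ : (QuadraticMap.associated (R := F) Q).SeparatingLeft) :
    ∃ (c : ι → F) (A : (ι → F) ≃ₗ[F] (ι → F)), (∀ i, c i ≠ 0) ∧ ∀ x, Q x = weightedSumSquares F c (A x) := by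
  classical
  obtain ⟨v, hv⟩ := LinearMap.BilinForm.exists_orthogonal_basis (QuadraticForm.associated_isSymm F Q)
  let σ : ι ≃ Fin (Module.finrank F (ι → F)) :=
    Fintype.equivFinOfCardEq (Module.finrank_fintype_fun_eq_card F).symm
  let v' : Module.Basis ι F (ι → F) := v.reindex σ.symm
  have hv' : (QuadraticMap.associated (R := F) Q).IsOrthoᵢ v' := by
    intro i j hij
    simp only [v', Function.onFun, Module.Basis.reindex_apply, Equiv.symm_symm]
    exact hv (σ.injective.ne hij)
  refine ⟨fun i => Q (v' i), (Q.isometryEquivBasisRepr v').toLinearEquiv, fun i => ?_, fun x => ?_⟩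
  · have h := hv'.not_isOrtho_basis_self_of_separatingLeft hQ i
    rwa [QuadraticMap.associated_eq_self_apply] at h
  · rw [← QuadraticMap.basisRepr_eq_of_iIsOrtho Q v' hv']
    exact ((Q.isometryEquivBasisRepr v').map_app x).symm

end Diagonal

variable [MeasurableSpace F] [BorelSpace F] (μ : Measure F) [μ.IsAddHaarMeasure] {ψ : AddChar F Circle}

/-! ## §3 Change of variables `g(f ∘ A, D) = ‖det A‖⁻¹ g(f, A D)` -/

section Change

/-- **equivalent forms**: `g(f ∘ A, D) = ‖det A‖⁻¹ · g(f, A(D))` for `A ∈ GL(F^ι)` (the module of `A` is `‖det A‖`).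
[cite: Weil1964, Chap. II n° 25, p. 173] -/
theorem gaussQF_comp_linearEquiv (Q : QuadraticForm F (ι → F)) (A : (ι → F) ≃ₗ[F] (ι → F)) (D : Set (ι → F)) :
    gaussQF ψ μ (Q.comp (A : (ι → F) →ₗ[F] (ι → F))) D =
      ((normAbs F (LinearMap.det (A : (ι → F) →ₗ[F] (ι → F)))⁻¹ : ℝ≥0) : ℝ) • gaussQF ψ μ Q (A '' D) := by
  rw [gaussQF_def, gaussQF_def, ← setIntegral_comp_linearEquiv μ A (psiQF ψ Q) D]
  rfl

/-- the same for a form GIVEN as `f = (Σ cᵢ xᵢ²) ∘ A`: `g(f, D) = ‖det A‖⁻¹ g(Σ cᵢ xᵢ², A(D))`.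
[cite: Weil1964, Chap. II n° 25, p. 173] -/
theorem gaussQF_eq_of_eq_weightedSumSquares {Q : QuadraticForm F (ι → F)} {c : ι → F}
    {A : (ι → F) ≃ₗ[F] (ι → F)} (hQ : ∀ x, Q x = weightedSumSquares F c (A x)) (D : Set (ι → F)) :
    gaussQF ψ μ Q D =
      ((normAbs F (LinearMap.det (A : (ι → F) →ₗ[F] (ι → F)))⁻¹ : ℝ≥0) : ℝ) • gaussPi ψ μ c (A '' D) := by
  have hQ' : Q = (weightedSumSquares F c).comp (A : (ι → F) →ₗ[F] (ι → F)) := QuadraticMap.ext fun y => hQ y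
  rw [hQ', gaussQF_comp_linearEquiv, gaussQF_weightedSumSquares]

end Change

/-! ## §4 Stabilisation, independence of the lattice, the stable value -/

section Stable

/-- **INDEPENDENCE OF THE LATTICE for a non-degenerate form** given as `f = (Σ cᵢ xᵢ²) ∘ A` (`cᵢ ≠ 0`, `2 ≠ 0`): there
are `ℓ` and `m₀ ≤ ℓ` such that `g(f, D) = ‖det A‖⁻¹ Πᵢ g(cᵢ)` for every compact `D ⊇ (𝔭^{m₀})^ι` stable under
`(𝔭^ℓ)^ι` — "`g(f, M)` est indépendant de `M` pourvu que `M ⊃ L'`". [cite: Weil1964, Chap. II n° 27, p. 175] -/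
theorem exists_forall_gaussQF_eq_of_eq_weightedSumSquares (hψ : ψ.IsContinuousNontrivial) (htwo : (2 : F) ≠ 0)
    {Q : QuadraticForm F (ι → F)} {c : ι → F} {A : (ι → F) ≃ₗ[F] (ι → F)} (hc : ∀ i, c i ≠ 0)
    (hQ : ∀ x, Q x = weightedSumSquares F c (A x)) :
    ∃ ℓ m₀ : ℤ, m₀ ≤ ℓ ∧ ∀ D : Set (ι → F), IsCompact D → (∀ x ∈ D, ∀ h ∈ primePowPiBox F ι ℓ, x + h ∈ D) →
      primePowPiBox F ι m₀ ⊆ D → gaussQF ψ μ Q D =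
        ((normAbs F (LinearMap.det (A : (ι → F) →ₗ[F] (ι → F)))⁻¹ : ℝ≥0) : ℝ) • ∏ i, weilGauss ψ μ (c i) := by
  obtain ⟨ℓ₁, m₁, hmℓ₁, h₁⟩ := exists_forall_gaussPi_eq_prod_weilGauss μ hψ hc htwo
  -- pull the two lattices back along `A`
  obtain ⟨ℓ, hℓ⟩ := exists_image_primePowPiBox_subset (A.symm : (ι → F) →ₗ[F] (ι → F)) ℓ₁
  obtain ⟨m₂, hm₂⟩ := exists_image_primePowPiBox_subset (A.symm : (ι → F) →ₗ[F] (ι → F)) m₁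
  refine ⟨ℓ, min ℓ m₂, min_le_left _ _, fun D hDc hDsat hDm => ?_⟩
  rw [gaussQF_eq_of_eq_weightedSumSquares μ hQ D]
  congr 1
  refine h₁ (A '' D) (hDc.image (LinearMap.continuous_on_pi (A : (ι → F) →ₗ[F] (ι → F)))) ?_ ?_
  · rintro _ ⟨y, hy, rfl⟩ h hh
    exact ⟨y + A.symm h, hDsat y hy _ (hℓ ⟨h, hh, rfl⟩), by simp⟩
  · intro z hz
    exact ⟨A.symm z, hDm (primePowPiBox_antitone (min_le_right _ _) (hm₂ ⟨z, hz, rfl⟩)), by simp⟩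

/-- hence the box integrals stabilise: `g(f, (𝔭^m)^ι) = ‖det A‖⁻¹ Πᵢ g(cᵢ)` for all `m` small enough.
[cite: Weil1964, Chap. II n° 27, p. 175] -/
theorem eventually_gaussQF_primePowPiBox_eq_of_eq_weightedSumSquares (hψ : ψ.IsContinuousNontrivial)
    (htwo : (2 : F) ≠ 0) {Q : QuadraticForm F (ι → F)} {c : ι → F} {A : (ι → F) ≃ₗ[F] (ι → F)} (hc : ∀ i, c i ≠ 0)
    (hQ : ∀ x, Q x = weightedSumSquares F c (A x)) :
    ∀ᶠ m in atBot, gaussQF ψ μ Q (primePowPiBox F ι m) =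
      ((normAbs F (LinearMap.det (A : (ι → F) →ₗ[F] (ι → F)))⁻¹ : ℝ≥0) : ℝ) • ∏ i, weilGauss ψ μ (c i) := by
  obtain ⟨ℓ, m₀, hmℓ, h⟩ := exists_forall_gaussQF_eq_of_eq_weightedSumSquares μ hψ htwo hc hQ
  filter_upwards [eventually_le_atBot m₀] with m hm
  exact h _ (isCompact_primePowPiBox m)
    (fun x hx k hk => add_mem_primePowPiBox hx (primePowPiBox_antitone (hm.trans hmℓ) hk))
    (primePowPiBox_antitone hm)

/-- **the stable value for ANY diagonalisation**: `g(f) = ‖det A‖⁻¹ Πᵢ g(cᵢ)` whenever `f = (Σ cᵢ xᵢ²) ∘ A`.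
[cite: Weil1964, Chap. II n° 27, p. 175] -/
theorem weilGaussQF_eq_of_eq_weightedSumSquares (hψ : ψ.IsContinuousNontrivial) (htwo : (2 : F) ≠ 0)
    {Q : QuadraticForm F (ι → F)} {c : ι → F} {A : (ι → F) ≃ₗ[F] (ι → F)} (hc : ∀ i, c i ≠ 0)
    (hQ : ∀ x, Q x = weightedSumSquares F c (A x)) :
    weilGaussQF ψ μ Q =
      ((normAbs F (LinearMap.det (A : (ι → F) →ₗ[F] (ι → F)))⁻¹ : ℝ≥0) : ℝ) • ∏ i, weilGauss ψ μ (c i) := by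
  have ht : Tendsto (fun m : ℤ => gaussQF ψ μ Q (primePowPiBox F ι m)) atBot
      (𝓝 (((normAbs F (LinearMap.det (A : (ι → F) →ₗ[F] (ι → F)))⁻¹ : ℝ≥0) : ℝ) • ∏ i, weilGauss ψ μ (c i))) :=
    tendsto_const_nhds.congr'
      ((eventually_gaussQF_primePowPiBox_eq_of_eq_weightedSumSquares μ hψ htwo hc hQ).mono fun _ hm => hm.symm)
  exact ht.limUnder_eq

variable [Invertible (2 : F)]

omit [ValuativeRel F] [TopologicalSpace F] [IsNonarchimedeanLocalField F] [MeasurableSpace F] [BorelSpace F] in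
/-- `2 ≠ 0` in `F` when `2` is invertible (helper). [folklore] -/
private theorem two_ne_zero' : (2 : F) ≠ 0 := Invertible.ne_zero 2

/-- **INDEPENDENCE OF THE LATTICE for a non-degenerate form** (characteristic `≠ 2`): there are `ℓ` and `m₀ ≤ ℓ` with
`g(f, D) = g(f)` for every compact `D ⊇ (𝔭^{m₀})^ι` stable under `(𝔭^ℓ)^ι`. [cite: Weil1964, Chap. II n° 27, p. 175] -/
theorem exists_forall_gaussQF_eq_weilGaussQF (hψ : ψ.IsContinuousNontrivial) {Q : QuadraticForm F (ι → F)}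
    (hQ : (QuadraticMap.associated (R := F) Q).SeparatingLeft) :
    ∃ ℓ m₀ : ℤ, m₀ ≤ ℓ ∧ ∀ D : Set (ι → F), IsCompact D → (∀ x ∈ D, ∀ h ∈ primePowPiBox F ι ℓ, x + h ∈ D) →
      primePowPiBox F ι m₀ ⊆ D → gaussQF ψ μ Q D = weilGaussQF ψ μ Q := by
  obtain ⟨c, A, hc, hQA⟩ := exists_weightedSumSquares_linearEquiv Q hQ
  obtain ⟨ℓ, m₀, hmℓ, h⟩ := exists_forall_gaussQF_eq_of_eq_weightedSumSquares μ hψ two_ne_zero' hc hQA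
  refine ⟨ℓ, m₀, hmℓ, fun D hDc hDsat hDm => ?_⟩
  rw [h D hDc hDsat hDm, weilGaussQF_eq_of_eq_weightedSumSquares μ hψ two_ne_zero' hc hQA]

/-- **`g(f, M) = g(f)` for all box lattices `M` large enough** ("indépendant de `M` … dès que `M` est assez grand").
[cite: Weil1964, Chap. II n° 27, p. 175] -/
theorem eventually_gaussQF_primePowPiBox_eq (hψ : ψ.IsContinuousNontrivial) {Q : QuadraticForm F (ι → F)}
    (hQ : (QuadraticMap.associated (R := F) Q).SeparatingLeft) :
    ∀ᶠ m in atBot, gaussQF ψ μ Q (primePowPiBox F ι m) = weilGaussQF ψ μ Q := by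
  obtain ⟨ℓ, m₀, hmℓ, h⟩ := exists_forall_gaussQF_eq_weilGaussQF μ hψ hQ
  filter_upwards [eventually_le_atBot m₀] with m hm
  exact h _ (isCompact_primePowPiBox m)
    (fun x hx k hk => add_mem_primePowPiBox hx (primePowPiBox_antitone (hm.trans hmℓ) hk))
    (primePowPiBox_antitone hm)

omit [Fintype ι] [MeasurableSpace F] [BorelSpace F] [Invertible (2 : F)] in
/-- the scalar `‖det A‖⁻¹` is a non-zero real number (helper). [folklore] -/
private theorem normAbs_det_inv_ne_zero (A : (ι → F) ≃ₗ[F] (ι → F)) :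
    ((normAbs F (LinearMap.det (A : (ι → F) →ₗ[F] (ι → F)))⁻¹ : ℝ≥0) : ℝ) ≠ 0 := by
  have hdet : (LinearMap.det (A : (ι → F) →ₗ[F] (ι → F)))⁻¹ ≠ 0 :=
    inv_ne_zero (by simpa using (LinearEquiv.isUnit_det' A).ne_zero)
  exact_mod_cast (normAbs_units_pos (Units.mk0 _ hdet)).ne'

/-- **`g(f) ≠ 0`** for non-degenerate `f`. [cite: Weil1964, Chap. II n° 27, p. 175] -/
theorem weilGaussQF_ne_zero (hψ : ψ.IsContinuousNontrivial) {Q : QuadraticForm F (ι → F)}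
    (hQ : (QuadraticMap.associated (R := F) Q).SeparatingLeft) : weilGaussQF ψ μ Q ≠ 0 := by
  obtain ⟨c, A, hc, hQA⟩ := exists_weightedSumSquares_linearEquiv Q hQ
  rw [weilGaussQF_eq_of_eq_weightedSumSquares μ hψ two_ne_zero' hc hQA]
  exact smul_ne_zero (normAbs_det_inv_ne_zero A)
    (Finset.prod_ne_zero_iff.2 fun i _ => weilGauss_ne_zero μ hψ (hc i) two_ne_zero')

/-- **`|γ(f)| = 1`** for non-degenerate `f`. [cite: Weil1964, Chap. II n° 24, p. 173] -/
theorem norm_weilIndexQF (hψ : ψ.IsContinuousNontrivial) {Q : QuadraticForm F (ι → F)}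
    (hQ : (QuadraticMap.associated (R := F) Q).SeparatingLeft) : ‖weilIndexQF ψ μ Q‖ = 1 := by
  rw [weilIndexQF, norm_div, Complex.norm_real, norm_norm,
    div_self (norm_ne_zero_iff.2 (weilGaussQF_ne_zero μ hψ hQ))]

/-- **`g(f) = γ(f) |g(f)|`** (Weil: `γ(f) m(L) = g(f) · (positive real)`). [cite: Weil1964, Chap. II n° 27, p. 175] -/
theorem weilGaussQF_eq_weilIndexQF_mul_norm (hψ : ψ.IsContinuousNontrivial) {Q : QuadraticForm F (ι → F)}
    (hQ : (QuadraticMap.associated (R := F) Q).SeparatingLeft) :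
    weilGaussQF ψ μ Q = weilIndexQF ψ μ Q * (‖weilGaussQF ψ μ Q‖ : ℂ) := by
  rw [weilIndexQF, div_mul_cancel₀]
  exact_mod_cast norm_ne_zero_iff.2 (weilGaussQF_ne_zero μ hψ hQ)

end Stable

/-! ## §5 `γ(f) = Π γ(cᵢ)`, equivalent forms, `γ(-f)`, orthogonal sums, the hyperbolic plane -/

section Index

variable [Invertible (2 : F)]

/-- **`γ(f) = Πᵢ γ(cᵢ xᵢ²)` for ANY diagonalisation `f = (Σ cᵢ xᵢ²) ∘ A`** (the positive factor `‖det A‖⁻¹` drops out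
of `g/|g|`; n° 25 Prop. 3 for the diagonal pieces). [cite: Weil1964, Chap. II n° 25 Prop. 3, p. 173] -/
theorem weilIndexQF_eq_prod_weilIndex (hψ : ψ.IsContinuousNontrivial) {Q : QuadraticForm F (ι → F)} {c : ι → F}
    {A : (ι → F) ≃ₗ[F] (ι → F)} (hc : ∀ i, c i ≠ 0) (hQ : ∀ x, Q x = weightedSumSquares F c (A x)) :
    weilIndexQF ψ μ Q = ∏ i, weilIndex ψ μ (c i) := by
  rw [weilIndexQF_def, weilGaussQF_eq_of_eq_weightedSumSquares μ hψ two_ne_zero' hc hQ]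
  set r : ℝ := ((normAbs F (LinearMap.det (A : (ι → F) →ₗ[F] (ι → F)))⁻¹ : ℝ≥0) : ℝ) with hr
  have hr0 : r ≠ 0 := normAbs_det_inv_ne_zero A
  have hrpos : 0 ≤ r := NNReal.coe_nonneg _
  rw [norm_smul, Real.norm_of_nonneg hrpos, Complex.real_smul, Complex.ofReal_mul,
    mul_div_mul_left _ _ (Complex.ofReal_ne_zero.2 hr0), norm_prod, Complex.ofReal_prod, ← Finset.prod_div_distrib]
  rfl

/-- in particular `γ(Σ cᵢ xᵢ²) = Πᵢ γ(cᵢ xᵢ²)`. [cite: Weil1964, Chap. II n° 25 Prop. 3, p. 173] -/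
theorem weilIndexQF_weightedSumSquares (hψ : ψ.IsContinuousNontrivial) {c : ι → F} (hc : ∀ i, c i ≠ 0) :
    weilIndexQF ψ μ (weightedSumSquares F c) = ∏ i, weilIndex ψ μ (c i) :=
  weilIndexQF_eq_prod_weilIndex μ hψ (A := LinearEquiv.refl F (ι → F)) hc fun _ => rfl

/-- **equivalent forms have the same Weil index**: `γ(f ∘ A) = γ(f)` for `A ∈ GL(F^ι)` ("si `f' = f ∘ ρ`, où `ρ` est un
isomorphisme … on a `γ(f') = γ(f)`"). [cite: Weil1964, Chap. II n° 25, p. 173] -/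
theorem weilIndexQF_comp_linearEquiv (hψ : ψ.IsContinuousNontrivial) {Q : QuadraticForm F (ι → F)}
    (hQ : (QuadraticMap.associated (R := F) Q).SeparatingLeft) (B : (ι → F) ≃ₗ[F] (ι → F)) :
    weilIndexQF ψ μ (Q.comp (B : (ι → F) →ₗ[F] (ι → F))) = weilIndexQF ψ μ Q := by
  obtain ⟨c, A, hc, hQA⟩ := exists_weightedSumSquares_linearEquiv Q hQ
  have hQB : ∀ x, Q.comp (B : (ι → F) →ₗ[F] (ι → F)) x = weightedSumSquares F c ((B.trans A) x) := fun x => by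
    rw [QuadraticMap.comp_apply, LinearEquiv.trans_apply]
    exact hQA (B x)
  rw [weilIndexQF_eq_prod_weilIndex μ hψ hc hQB, weilIndexQF_eq_prod_weilIndex μ hψ hc hQA]

/-- the stable values of equivalent forms differ by the module: `g(f ∘ B) = ‖det B‖⁻¹ g(f)`.
[cite: Weil1964, Chap. II n° 25, p. 173] -/
theorem weilGaussQF_comp_linearEquiv (hψ : ψ.IsContinuousNontrivial) {Q : QuadraticForm F (ι → F)}
    (hQ : (QuadraticMap.associated (R := F) Q).SeparatingLeft) (B : (ι → F) ≃ₗ[F] (ι → F)) :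
    weilGaussQF ψ μ (Q.comp (B : (ι → F) →ₗ[F] (ι → F))) =
      ((normAbs F (LinearMap.det (B : (ι → F) →ₗ[F] (ι → F)))⁻¹ : ℝ≥0) : ℝ) • weilGaussQF ψ μ Q := by
  obtain ⟨c, A, hc, hQA⟩ := exists_weightedSumSquares_linearEquiv Q hQ
  have hQB : ∀ x, Q.comp (B : (ι → F) →ₗ[F] (ι → F)) x = weightedSumSquares F c ((B.trans A) x) := fun x => by
    rw [QuadraticMap.comp_apply, LinearEquiv.trans_apply]
    exact hQA (B x)
  rw [weilGaussQF_eq_of_eq_weightedSumSquares μ hψ two_ne_zero' hc hQB,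
    weilGaussQF_eq_of_eq_weightedSumSquares μ hψ two_ne_zero' hc hQA, smul_smul, LinearEquiv.coe_trans,
    LinearMap.det_comp, mul_inv, map_mul, NNReal.coe_mul, mul_comm]

/-- **`γ(-f) = conj γ(f)`** (`χ ∘ (-f)` is the conjugate of `χ ∘ f`; so `γ(-f) = γ(f)⁻¹`). [cite: Weil1964, Chap. II n° 25, p. 173] -/
theorem weilIndexQF_neg (hψ : ψ.IsContinuousNontrivial) {Q : QuadraticForm F (ι → F)}
    (hQ : (QuadraticMap.associated (R := F) Q).SeparatingLeft) :
    weilIndexQF ψ μ (-Q) = (starRingEnd ℂ) (weilIndexQF ψ μ Q) := by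
  obtain ⟨c, A, hc, hQA⟩ := exists_weightedSumSquares_linearEquiv Q hQ
  have hQn : ∀ x, (-Q) x = weightedSumSquares F (-c) (A x) := fun x => by
    rw [QuadraticMap.neg_apply, hQA, weightedSumSquares_apply, weightedSumSquares_apply, ← Finset.sum_neg_distrib]
    exact Finset.sum_congr rfl fun i _ => by simp [smul_eq_mul]
  rw [weilIndexQF_eq_prod_weilIndex μ hψ (fun i => neg_ne_zero.2 (hc i)) hQn,
    weilIndexQF_eq_prod_weilIndex μ hψ hc hQA, map_prod]
  exact Finset.prod_congr rfl fun i _ => weilIndex_neg μ hψ (hc i) two_ne_zero'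

/-- **`γ(-f) γ(f) = 1`**. [cite: Weil1964, Chap. II n° 25, p. 173] -/
theorem weilIndexQF_neg_mul_self (hψ : ψ.IsContinuousNontrivial) {Q : QuadraticForm F (ι → F)}
    (hQ : (QuadraticMap.associated (R := F) Q).SeparatingLeft) :
    weilIndexQF ψ μ (-Q) * weilIndexQF ψ μ Q = 1 := by
  rw [weilIndexQF_neg μ hψ hQ, Complex.conj_mul', norm_weilIndexQF μ hψ hQ]
  norm_num

/-- **`γ(f)` does not depend on the choice of the Haar measure** ("changing the measures modifies the formulas … only
by real factors `> 0`"). [cite: Weil1964, Chap. II n° 24, p. 173] -/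
theorem weilIndexQF_eq_of_isAddHaarMeasure (μ' : Measure F) [μ'.IsAddHaarMeasure] (hψ : ψ.IsContinuousNontrivial)
    {Q : QuadraticForm F (ι → F)} (hQ : (QuadraticMap.associated (R := F) Q).SeparatingLeft) :
    weilIndexQF ψ μ' Q = weilIndexQF ψ μ Q := by
  obtain ⟨c, A, hc, hQA⟩ := exists_weightedSumSquares_linearEquiv Q hQ
  rw [weilIndexQF_eq_prod_weilIndex μ' hψ hc hQA, weilIndexQF_eq_prod_weilIndex μ hψ hc hQA]
  exact Finset.prod_congr rfl fun i _ => weilIndex_eq_of_isAddHaarMeasure μ μ' hψ (hc i) two_ne_zero'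

/-- **orthogonal sums in disjoint sets of variables (Prop. 3)**: if `f(x) = f₁(x|_{ι₁}) + f₂(x|_{ι₂})` on
`F^{ι₁ ⊔ ι₂}` with `f₁, f₂` non-degenerate, then `γ(f) = γ(f₁) γ(f₂)` ("l'application `f → γ(f)` détermine un
caractère du groupe de Witt"). [cite: Weil1964, Chap. II n° 25 Prop. 3, p. 173] -/
theorem weilIndexQF_sum {ι₁ ι₂ : Type*} [Fintype ι₁] [Fintype ι₂] (hψ : ψ.IsContinuousNontrivial)
    {Q₁ : QuadraticForm F (ι₁ → F)} {Q₂ : QuadraticForm F (ι₂ → F)} {Q : QuadraticForm F (ι₁ ⊕ ι₂ → F)}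
    (hQ₁ : (QuadraticMap.associated (R := F) Q₁).SeparatingLeft)
    (hQ₂ : (QuadraticMap.associated (R := F) Q₂).SeparatingLeft)
    (hsum : ∀ x, Q x = Q₁ (fun i => x (Sum.inl i)) + Q₂ (fun j => x (Sum.inr j))) :
    weilIndexQF ψ μ Q = weilIndexQF ψ μ Q₁ * weilIndexQF ψ μ Q₂ := by
  obtain ⟨c₁, A₁, hc₁, hQA₁⟩ := exists_weightedSumSquares_linearEquiv Q₁ hQ₁
  obtain ⟨c₂, A₂, hc₂, hQA₂⟩ := exists_weightedSumSquares_linearEquiv Q₂ hQ₂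
  -- the block-diagonal automorphism `A₁ ⊕ A₂` of `F^{ι₁ ⊔ ι₂}`
  let S := LinearEquiv.sumArrowLequivProdArrow ι₁ ι₂ F F
  let A : (ι₁ ⊕ ι₂ → F) ≃ₗ[F] (ι₁ ⊕ ι₂ → F) := (S.trans (A₁.prodCongr A₂)).trans S.symm
  have hA : ∀ x, A x = Sum.elim (A₁ fun i => x (Sum.inl i)) (A₂ fun j => x (Sum.inr j)) := by
    intro x
    funext k
    rcases k with i | j
    · simp only [A, S, LinearEquiv.trans_apply, LinearEquiv.prodCongr_apply, Sum.elim_inl,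
        LinearEquiv.sumArrowLequivProdArrow_symm_apply_inl]
      rfl
    · simp only [A, S, LinearEquiv.trans_apply, LinearEquiv.prodCongr_apply, Sum.elim_inr,
        LinearEquiv.sumArrowLequivProdArrow_symm_apply_inr]
      rfl
  have hc : ∀ k, Sum.elim c₁ c₂ k ≠ 0 := by rintro (i | j) <;> simp [hc₁, hc₂]
  have hQA : ∀ x, Q x = weightedSumSquares F (Sum.elim c₁ c₂) (A x) := by
    intro x
    rw [hsum, hQA₁, hQA₂, hA, weightedSumSquares_apply, weightedSumSquares_apply, weightedSumSquares_apply,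
      Fintype.sum_sum_type]
    simp only [Sum.elim_inl, Sum.elim_inr]
  rw [weilIndexQF_eq_prod_weilIndex μ hψ hc hQA, weilIndexQF_eq_prod_weilIndex μ hψ hc₁ hQA₁,
    weilIndexQF_eq_prod_weilIndex μ hψ hc₂ hQA₂, Fintype.prod_sum_type]
  simp only [Sum.elim_inl, Sum.elim_inr]

/-- the linear automorphism `(x, y) ↦ ((x + y)/2, (x - y)/2)` of `F²` diagonalising the hyperbolic plane:
`x y = ((x+y)/2)² - ((x-y)/2)²` (plumbing for `weilIndexQF_hyperbolicPlane`). [cite: Weil1964, Chap. II n° 25, p. 173] -/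
def hyperbolicDiag : (Fin 2 → F) ≃ₗ[F] (Fin 2 → F) where
  toFun x := ![⅟(2 : F) * (x 0 + x 1), ⅟(2 : F) * (x 0 - x 1)]
  invFun y := ![y 0 + y 1, y 0 - y 1]
  map_add' x y := by
    funext i; fin_cases i <;> simp <;> ring
  map_smul' a x := by
    funext i; fin_cases i <;> simp <;> ring
  left_inv x := by
    funext i
    fin_cases i
    · simp only [Fin.zero_eta, Fin.isValue, Matrix.cons_val_zero, Matrix.cons_val_one]
      rw [← mul_add, add_add_sub_cancel, ← two_mul, ← mul_assoc, invOf_mul_self, one_mul]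
    · simp only [Fin.mk_one, Fin.isValue, Matrix.cons_val_one, Matrix.cons_val_zero]
      rw [← mul_sub, add_sub_sub_cancel, ← two_mul, ← mul_assoc, invOf_mul_self, one_mul]
  right_inv y := by
    funext i
    fin_cases i
    · simp only [Fin.zero_eta, Fin.isValue, Matrix.cons_val_zero, Matrix.cons_val_one]
      rw [add_add_sub_cancel, ← two_mul, ← mul_assoc, invOf_mul_self, one_mul]
    · simp only [Fin.mk_one, Fin.isValue, Matrix.cons_val_one, Matrix.cons_val_zero]
      rw [add_sub_sub_cancel, ← two_mul, ← mul_assoc, invOf_mul_self, one_mul]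

omit [ValuativeRel F] [TopologicalSpace F] [IsNonarchimedeanLocalField F] [MeasurableSpace F] [BorelSpace F] in
/-- unfolding of `hyperbolicDiag`. [cite: Weil1964, Chap. II n° 25, p. 173] -/
@[simp] theorem hyperbolicDiag_apply (x : Fin 2 → F) :
    hyperbolicDiag x = ![⅟(2 : F) * (x 0 + x 1), ⅟(2 : F) * (x 0 - x 1)] := rfl

omit [ValuativeRel F] [TopologicalSpace F] [IsNonarchimedeanLocalField F] [MeasurableSpace F] [BorelSpace F] in
/-- `x y = ((x+y)/2)² - ((x-y)/2)²`: the hyperbolic plane `proj 0 1` is `(u² - v²) ∘ hyperbolicDiag`.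
[cite: Weil1964, Chap. II n° 25, p. 173] -/
theorem proj_eq_weightedSumSquares_hyperbolicDiag (x : Fin 2 → F) :
    (QuadraticMap.proj 0 1 : QuadraticForm F (Fin 2 → F)) x =
      weightedSumSquares F ![(1 : F), -1] (hyperbolicDiag x) := by
  rw [QuadraticMap.proj_apply, weightedSumSquares_apply, Fin.sum_univ_two, hyperbolicDiag_apply]
  simp only [Matrix.cons_val_zero, Matrix.cons_val_one, smul_eq_mul, one_mul, neg_mul, Fin.isValue]
  have h4 : (⅟(2 : F)) * ⅟(2 : F) * 4 = 1 := by
    rw [show (4 : F) = 2 * 2 by norm_num, ← mul_assoc, mul_assoc (⅟(2:F)), invOf_mul_self, mul_one, invOf_mul_self]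
  linear_combination (-(x 0 * x 1)) * h4

/-- **the hyperbolic plane has Weil index `1`**: `γ(x y) = γ(u²) γ(-v²) = 1` ("une forme triviale … `γ(f) = 1`").
[cite: Weil1964, Chap. II n° 25, p. 173] -/
theorem weilIndexQF_hyperbolicPlane (hψ : ψ.IsContinuousNontrivial) :
    weilIndexQF ψ μ (QuadraticMap.proj 0 1 : QuadraticForm F (Fin 2 → F)) = 1 := by
  have hc : ∀ i : Fin 2, (![(1 : F), -1]) i ≠ 0 := by
    intro i; fin_cases i <;> simp
  rw [weilIndexQF_eq_prod_weilIndex μ hψ hc (proj_eq_weightedSumSquares_hyperbolicDiag (F := F)),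
    Fin.prod_univ_two]
  simp only [Matrix.cons_val_zero, Matrix.cons_val_one, Fin.isValue]
  rw [mul_comm]
  exact weilIndex_neg_mul_self μ hψ one_ne_zero two_ne_zero'

omit [ValuativeRel F] [TopologicalSpace F] [IsNonarchimedeanLocalField F] [Fintype ι] [MeasurableSpace F]
  [BorelSpace F] in
/-- non-degeneracy is preserved under equivalence: if `associated f` is left-separating, so is `associated (f ∘ e)`
for a linear isomorphism `e` (equivalent forms, n° 25). [cite: Weil1964, Chap. II n° 25, p. 173] -/
theorem separatingLeft_associated_comp {V W : Type*} [AddCommGroup V] [Module F V] [AddCommGroup W] [Module F W]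
    {Q : QuadraticForm F V} (hQ : (QuadraticMap.associated (R := F) Q).SeparatingLeft) (e : W ≃ₗ[F] V) :
    (QuadraticMap.associated (R := F) (Q.comp (e : W →ₗ[F] V))).SeparatingLeft := by
  intro x hx
  rw [← e.map_eq_zero_iff]
  refine hQ (e x) fun y => ?_
  have h := hx (e.symm y)
  rw [QuadraticMap.associated_comp, LinearMap.compl₁₂_apply] at h
  simpa using h

/-- **the Weil index of a form on an abstract space is basis-independent**: for a non-degenerate quadratic form `f`
on a finite-dimensional `F`-space `V`, the index of its coordinate expression `f.basisRepr b` (a form on `F^ι`) is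
the same for all bases `b` of `V` indexed by `ι` (two coordinate expressions are equivalent forms; n° 25: "il ne
faudra pas oublier qu'alors le symbole `γ(f)` dépend du choix de `χ`" — but not of coordinates).
[cite: Weil1964, Chap. II n° 25, p. 173] -/
theorem weilIndexQF_basisRepr_eq (hψ : ψ.IsContinuousNontrivial) {V : Type*} [AddCommGroup V] [Module F V]
    {Q : QuadraticForm F V} (hQ : (QuadraticMap.associated (R := F) Q).SeparatingLeft) (b b' : Module.Basis ι F V) :
    weilIndexQF ψ μ (Q.basisRepr b) = weilIndexQF ψ μ (Q.basisRepr b') := by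
  let E : (ι → F) ≃ₗ[F] (ι → F) := b'.equivFun.symm.trans b.equivFun
  have hE : Q.basisRepr b' = (Q.basisRepr b).comp (E : (ι → F) →ₗ[F] (ι → F)) := by
    refine QuadraticMap.ext fun x => ?_
    simp only [QuadraticMap.basisRepr, QuadraticMap.comp_apply, E, LinearEquiv.coe_coe, LinearEquiv.trans_apply,
      LinearEquiv.symm_apply_apply]
  have hb : (QuadraticMap.associated (R := F) (Q.basisRepr b)).SeparatingLeft :=
    separatingLeft_associated_comp hQ b.equivFun.symm
  rw [hE, weilIndexQF_comp_linearEquiv μ hψ hb E]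

omit [ValuativeRel F] [TopologicalSpace F] [IsNonarchimedeanLocalField F] [Fintype ι] [MeasurableSpace F]
  [BorelSpace F] in
/-- `-f` is non-degenerate when `f` is (its associated form is `-(associated f)`).
[cite: Weil1964, Chap. II n° 25, p. 173] -/
theorem separatingLeft_associated_neg {V : Type*} [AddCommGroup V] [Module F V] {Q : QuadraticForm F V}
    (hQ : (QuadraticMap.associated (R := F) Q).SeparatingLeft) :
    (QuadraticMap.associated (R := F) (-Q)).SeparatingLeft := by
  intro x hx
  refine hQ x fun y => ?_
  have h := hx y
  rw [map_neg, LinearMap.neg_apply, LinearMap.neg_apply, neg_eq_zero] at h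
  exact h

/-- **Witt-trivial forms have Weil index `1`**: for `f` non-degenerate, the form `f(x|_{ι}) - f(x|_{ι'})` on `F^{ι ⊔ ι}`
(equivalent to `Σ xᵢ x_{n+i}`, the class `0` of the Witt group) has `γ = γ(f) γ(-f) = 1` ("une forme triviale …
`γ(f) = 1`"; with `weilIndexQF_sum` and `weilIndexQF_comp_linearEquiv`: `γ` factors through the Witt group, Prop. 3).
[cite: Weil1964, Chap. II n° 25 Prop. 3, p. 173] -/
theorem weilIndexQF_sum_neg_self (hψ : ψ.IsContinuousNontrivial) {Q : QuadraticForm F (ι → F)}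
    {Q' : QuadraticForm F (ι ⊕ ι → F)} (hQ : (QuadraticMap.associated (R := F) Q).SeparatingLeft)
    (hsum : ∀ x, Q' x = Q (fun i => x (Sum.inl i)) - Q (fun j => x (Sum.inr j))) :
    weilIndexQF ψ μ Q' = 1 := by
  rw [weilIndexQF_sum μ hψ hQ (separatingLeft_associated_neg hQ) (Q := Q')
      (fun x => by rw [hsum, QuadraticMap.neg_apply, sub_eq_add_neg]),
    mul_comm, weilIndexQF_neg_mul_self μ hψ hQ]

end Index

/-! ## §6 The modulus `|g(f)|` (Weil's `|g(f)| = |ρ|^{-1/2}` normalisation) -/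

section Modulus

omit [Fintype ι] [MeasurableSpace F] [BorelSpace F] in
/-- a character with a conductor exponent is continuous and non-trivial (helper: level `d` means trivial on `𝔭^d`,
non-trivial on `𝔭^{d-1}`). [cite: BushnellHenniart2006, §1.7] -/
theorem isContinuousNontrivial_of_hasConductorExp {d : ℤ} (hd : ψ.HasConductorExp d) : ψ.IsContinuousNontrivial := by
  refine ⟨continuous_of_hasConductorExp hd, fun h0 => ?_⟩
  obtain ⟨x, -, hx⟩ := hd.2
  exact hx (by rw [h0]; rfl)

/-- **the modulus of the stable Gauss integral of a non-degenerate form**: for `f = (Σ cᵢ xᵢ²) ∘ A` (`cᵢ ≠ 0`,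
`A ∈ GL(F^ι)`) and `ψ` of conductor exponent `d`,
`|g(f)|² = ‖det A‖⁻² · Πᵢ (q^{-d} μ(𝒪)² · ‖2cᵢ‖⁻¹)` — Weil's `|g(f)| = |ρ|^{-1/2} m(L)`-type normalisation
(`selfDualConst μ d = q^{-d} μ(𝒪)²` is `1` for the self-dual measure), coordinate by coordinate and through the module
of `A`. [cite: Weil1964, Chap. I n° 14 Thm 2 Cor. 2, p. 162; Chap. II n° 27, p. 175] -/
theorem norm_sq_weilGaussQF_of_eq_weightedSumSquares {d : ℤ} (hd : ψ.HasConductorExp d) (htwo : (2 : F) ≠ 0)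
    {Q : QuadraticForm F (ι → F)} {c : ι → F} {A : (ι → F) ≃ₗ[F] (ι → F)} (hc : ∀ i, c i ≠ 0)
    (hQ : ∀ x, Q x = weightedSumSquares F c (A x)) :
    ‖weilGaussQF ψ μ Q‖ ^ 2 =
      (((normAbs F (LinearMap.det (A : (ι → F) →ₗ[F] (ι → F)))⁻¹ : ℝ≥0) : ℝ)) ^ 2 *
        ∏ i, (selfDualConst μ d * (((normAbs F (2 * c i))⁻¹ : ℝ≥0) : ℝ)) := by
  obtain ⟨v₂, hv₂⟩ := exists_normAbs_eq_inv_zpow htwo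
  rw [weilGaussQF_eq_of_eq_weightedSumSquares μ (isContinuousNontrivial_of_hasConductorExp hd) htwo hc hQ, norm_smul,
    mul_pow, Real.norm_of_nonneg (NNReal.coe_nonneg _), norm_prod, ← Finset.prod_pow]
  congr 1
  refine Finset.prod_congr rfl fun i _ => ?_
  obtain ⟨vi, hvi⟩ := exists_normAbs_eq_inv_zpow (hc i)
  exact norm_sq_weilGauss_eq_selfDualConst_mul μ hd hvi hv₂

end Modulus

end Literature.NumberTheory.Weil1964
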